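import Literature.NumberTheory.Transcendental.SiegelEntries
import Literature.NumberTheory.Transcendental.LineODETheta
import Literature.NumberTheory.Transcendental.SigmaLatticeAutomorphy
import Literature.NumberTheory.Transcendental.UnivExtChartTheta
import Literature.NumberTheory.EllipticCurves.WeierstrassTorsion
import HarnessLib

/-!
# A lower bound for the base theta function at the points `s·v`

Topic: `Literature/NumberTheory/Transcendental`. Plan item W4/S5(e4) of the unit
`provefact-Literature.NumberTheory.Transcendental.H-b596640137`. The arithmetic step of Baker's
method compares `φ_{x,k}(s') = Θ_{J₀}(s'v)^D · (algebraic number)` (`Extrapolation.lean`,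
`JetTransfer.lean`) with a Liouville bound, and therefore needs a LOWER bound for the base theta
function `Θ_{J₀(c_{s'})}(s'·v) = ∏_b P_{i_b}(s'z_b)` (`LineODETheta.theta_baseIdx`) at the points
`s'·v`, `s' ∈ ℕ`. Since the `E`-coordinates of `v` are torsion logarithms (`N z_b ∈ Λ`,
`BakerData.tc`), `s' z_b = r z_b + q·(N z_b)` with `r < N`, and the quasi-periodicity of `σ`
(`SigmaLatticeAutomorphy.lean`) gives the explicit dependence on `q`. PROVED:

* `PeriodPair.sigmaDeriv_one_lattice` — `σ′(mω₁ + nω₂) = (-1)^{m+n+mn} e^{η(λ)λ/2}`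
  (differentiate `σ(z + λ) = (automorphy factor)·σ(z)` at `z = 0`);
* `PeriodPair.norm_univExtP_two_lattice` — `|P₂(λ)| = 2·e^{3·Re(η(λ)λ/2)}`;
* `PeriodPair.norm_sigmaLatticeAut_ge` — `|automorphy factor| ≥ e^{-|η(λ)|·(|z| + |λ|/2)}`;
* `BakerData.exists_theta_baseIdx_ge` — **there are `c > 0` and `C ≥ 0` (depending only on the
  data) with `|Θ_{J₀(c_{s})}(s·v)| ≥ c^{|γ|}·e^{-C(1 + s²)}`-type bound, precisely
  `c * Real.exp (-(C * (1 + s^2))) ≤ ‖Θ_{J₀(cAt s)}(s·v)‖` for all `s : ℕ`.**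

## References

* A. Baker, G. Wüstholz, *Logarithmic Forms and Diophantine Geometry*, CUP 2007, §6.8 (p. 119).
* E. T. Whittaker, G. N. Watson, *A Course of Modern Analysis*, §20.421.
-/

noncomputable section

open Complex
open scoped PeriodPair

namespace Literature.NumberTheory.Transcendental

variable {L : PeriodPair}

/-! ### `σ′` and `P₂` at lattice points -/

/-- **`σ′(λ) = (-1)^{m+n+mn} e^{η(λ)λ/2}`** for `λ = mω₁ + nω₂`. [cite: WhittakerWatson1927, §20.421] -/
theorem _root_.PeriodPair.sigmaDeriv_one_lattice (L : PeriodPair) (m n : ℤ) :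
    L.sigmaDeriv 1 (m * L.ω₁ + n * L.ω₂) = L.sigmaLatticeAut m n 0 := by
  set lam : ℂ := m * L.ω₁ + n * L.ω₂ with hlam
  -- differentiate `σ(z + λ) = A(z) σ(z)` at `z = 0`
  have hσ : Differentiable ℂ L.weierstrassSigma := L.differentiable_weierstrassSigma_holds
  have hA : Differentiable ℂ (L.sigmaLatticeAut m n) := by
    unfold PeriodPair.sigmaLatticeAut
    fun_prop
  have h1 : HasDerivAt (fun z => L.weierstrassSigma (z + lam)) (L.sigmaDeriv 1 lam) 0 := by
    have h0 : HasDerivAt L.weierstrassSigma (deriv L.weierstrassSigma (0 + lam)) ((0 : ℂ) + lam) := by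
      rw [zero_add]; exact (hσ lam).hasDerivAt
    have := h0.comp_add_const (0 : ℂ) lam
    simpa [PeriodPair.sigmaDeriv_one] using this
  have h2 : HasDerivAt (fun z => L.sigmaLatticeAut m n z * L.weierstrassSigma z)
      (deriv (L.sigmaLatticeAut m n) 0 * L.weierstrassSigma 0 + L.sigmaLatticeAut m n 0 * 1) 0 :=
    (hA 0).hasDerivAt.mul L.hasDerivAt_weierstrassSigma_zero
  have heq : (fun z => L.weierstrassSigma (z + lam)) = fun z => L.sigmaLatticeAut m n z * L.weierstrassSigma z := by
    funext z; exact L.weierstrassSigma_add_lattice m n z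
  rw [heq] at h1
  have := h1.unique h2
  rw [this]
  simp

/-- **`|P₂(λ)| = 2·|σ′(λ)|³ = 2·e^{3·Re(η(λ)·λ/2)}`.** [folklore] -/
theorem _root_.PeriodPair.norm_univExtP_two_lattice (L : PeriodPair) (m n : ℤ) :
    ‖L.univExtP 2 (m * L.ω₁ + n * L.ω₂)‖ =
      2 * Real.exp (((m * L.η₁ + n * L.η₂) * ((m * L.ω₁ + n * L.ω₂) / 2)).re) ^ 3 := by
  have hσ0 : L.weierstrassSigma (m * L.ω₁ + n * L.ω₂) = 0 :=
    (L.weierstrassSigma_eq_zero_iff_holds _).mpr (L.int_mul_add_int_mul_mem_lattice m n)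
  obtain ⟨-, -, p2, -⟩ := PeriodPair.univExtP_univExtZ_of_sigma_eq_zero hσ0
  rw [p2, L.sigmaDeriv_one_lattice, norm_mul, norm_neg, norm_pow, PeriodPair.sigmaLatticeAut, norm_mul,
    norm_zpow, norm_neg, norm_one, one_zpow, one_mul, Complex.norm_exp]
  simp

/-- The automorphy factor is bounded below explicitly:
`|A_{m,n}(z)| ≥ e^{-‖η(λ)‖·(‖z‖ + ‖λ‖/2)}`. [folklore] -/
theorem _root_.PeriodPair.norm_sigmaLatticeAut_ge (L : PeriodPair) (m n : ℤ) (z : ℂ) :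
    Real.exp (-(‖(m * L.η₁ + n * L.η₂ : ℂ)‖ * (‖z‖ + ‖(m * L.ω₁ + n * L.ω₂ : ℂ)‖ / 2))) ≤
      ‖L.sigmaLatticeAut m n z‖ := by
  rw [PeriodPair.sigmaLatticeAut, norm_mul, norm_zpow, norm_neg, norm_one, one_zpow, one_mul,
    Complex.norm_exp]
  refine Real.exp_le_exp.mpr ?_
  have h1 : -‖(m * L.η₁ + n * L.η₂) * (z + (m * L.ω₁ + n * L.ω₂) / 2)‖ ≤
      ((m * L.η₁ + n * L.η₂) * (z + (m * L.ω₁ + n * L.ω₂) / 2)).re := by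
    have := Complex.abs_re_le_norm ((m * L.η₁ + n * L.η₂) * (z + (m * L.ω₁ + n * L.ω₂) / 2))
    have := neg_abs_le ((m * L.η₁ + n * L.η₂) * (z + (m * L.ω₁ + n * L.ω₂) / 2)).re
    linarith
  refine le_trans ?_ h1
  rw [norm_mul, neg_le_neg_iff]
  refine mul_le_mul_of_nonneg_left ?_ (norm_nonneg _)
  refine (norm_add_le _ _).trans (add_le_add le_rfl ?_)
  rw [norm_div]
  simp

/-! ### The base theta function at the points `s·v` -/

namespace GaGmE

namespace Std

namespace BakerData

variable {β γ δ : Type} [Fintype β] [Fintype γ] [Fintype δ] [DecidableEq γ]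
variable (B : BakerData β γ δ)

/-- `s ≤ 1 + s²` and `s² ≤ 1 + s²` packaged: `a·s + b·s² ≤ (a + b)(1 + s²)` for `a, b ≥ 0`. [folklore] -/
theorem lin_quad_le {a b : ℝ} (ha : 0 ≤ a) (hb : 0 ≤ b) (s : ℕ) :
    a * s + b * (s : ℝ) ^ 2 ≤ (a + b) * (1 + (s : ℝ) ^ 2) := by
  have hs : (0 : ℝ) ≤ s := Nat.cast_nonneg s
  nlinarith [sq_nonneg ((s : ℝ) - 1)]

/-- **Per-factor lower bound.** For each `E`-factor `b` there are `c > 0`, `C ≥ 0` with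
`c·e^{-C(1+s²)} ≤ |P_{i_b(s)}(s·z_b)|` for all `s ∈ ℕ`, where `i_b(s) = 2` if `s z_b ∈ Λ` (chart at
the origin) and `0` otherwise. [folklore] -/
theorem exists_univExtP_base_ge (b : γ) : ∃ c : ℝ, 0 < c ∧ ∃ C : ℝ, 0 ≤ C ∧ ∀ s : ℕ,
    c * Real.exp (-(C * (1 + (s : ℝ) ^ 2))) ≤
      ‖B.L.univExtP (baseFin (B.cAt s b)) ((s : ℂ) * B.v (iz b))‖ := by
  classical
  set z : ℂ := B.v (iz b) with hz
  have hN0 : 0 < B.N := B.hN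
  set lam : ℂ := (B.tc.m b : ℂ) * B.L.ω₁ + (B.tc.n b : ℂ) * B.L.ω₂ with hlam
  have hNz : (B.N : ℂ) * z = lam := B.tc.eq b
  -- lattice coordinates of the `r z ∈ Λ`
  have hco : ∀ r : ℕ, ∃ ac : ℤ × ℤ, ((r : ℂ) * z ∈ B.L.lattice → (ac.1 : ℂ) * B.L.ω₁ + (ac.2 : ℂ) * B.L.ω₂ = (r : ℂ) * z) := by
    intro r
    by_cases h : (r : ℂ) * z ∈ B.L.lattice
    · obtain ⟨m, n, hmn⟩ := PeriodPair.mem_lattice.mp h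
      exact ⟨(m, n), fun _ => hmn⟩
    · exact ⟨(0, 0), fun h' => absurd h' h⟩
  choose ac hac using hco
  -- constants
  set Aη : ℝ := ∑ r ∈ Finset.range B.N, ‖((ac r).1 : ℂ) * B.L.η₁ + ((ac r).2 : ℂ) * B.L.η₂‖ with hAη
  set Hη : ℝ := ‖(B.tc.m b : ℂ) * B.L.η₁ + (B.tc.n b : ℂ) * B.L.η₂‖ with hHη
  have hAη0 : 0 ≤ Aη := Finset.sum_nonneg fun _ _ => norm_nonneg _
  have hHη0 : 0 ≤ Hη := norm_nonneg _
  set μf : ℕ → ℝ := fun r => if (r : ℂ) * z ∈ B.L.lattice then 1 else ‖B.L.weierstrassSigma ((r : ℂ) * z)‖ with hμf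
  have hne : (Finset.range B.N).Nonempty := ⟨0, Finset.mem_range.mpr hN0⟩
  set μ : ℝ := (Finset.range B.N).inf' hne μf with hμ
  have hμpos : 0 < μ := by
    rw [hμ, Finset.lt_inf'_iff]
    intro r _
    simp only [hμf]
    split_ifs with h
    · exact one_pos
    · exact norm_pos_iff.mpr (B.L.weierstrassSigma_ne_zero h)
  have hμle : ∀ r < B.N, (r : ℂ) * z ∉ B.L.lattice → μ ≤ ‖B.L.weierstrassSigma ((r : ℂ) * z)‖ := by
    intro r hr hnot
    have := Finset.inf'_le μf (Finset.mem_range.mpr hr)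
    simp only [hμf, if_neg hnot] at this
    rw [hμ]; exact this
  set Clat : ℝ := 3 / 2 * ‖z‖ * (Aη + Hη) with hClat
  set Cgen : ℝ := Hη * (B.N * ‖z‖ + ‖lam‖ / 2) * 2 with hCgen
  refine ⟨min 2 (μ ^ 3), lt_min two_pos (pow_pos hμpos 3), max Clat (3 * Cgen),
    le_max_of_le_left (by rw [hClat]; exact mul_nonneg (mul_nonneg (by norm_num) (norm_nonneg _)) (add_nonneg hAη0 hHη0)),
    fun s => ?_⟩
  -- `s = qN + r`
  set q := s / B.N with hq
  set r := s % B.N with hr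
  have hs : s = q * B.N + r := by rw [hq, hr, Nat.div_add_mod' s B.N]
  have hrN : r < B.N := Nat.mod_lt s hN0
  have hqs : (q : ℝ) ≤ s := by exact_mod_cast Nat.div_le_self s B.N
  have hs0 : (0 : ℝ) ≤ s := Nat.cast_nonneg s
  have hdecomp : (s : ℂ) * z = (r : ℂ) * z + (((q * B.tc.m b : ℤ) : ℂ) * B.L.ω₁ + ((q * B.tc.n b : ℤ) : ℂ) * B.L.ω₂) := by
    have := B.tc.mul_coord q r b
    rw [← hs] at this
    simpa [hz] using this
  -- generic bound on `e^{-C(1+s²)}` monotonicity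
  have hexp_mono : ∀ {C C' : ℝ}, C ≤ C' → Real.exp (-(C' * (1 + (s : ℝ) ^ 2))) ≤ Real.exp (-(C * (1 + (s : ℝ) ^ 2))) :=
    fun h => Real.exp_le_exp.mpr (neg_le_neg (mul_le_mul_of_nonneg_right h (by positivity)))
  have hcAt : B.cAt s b = (if (s : ℂ) * z ∈ B.L.lattice then true else false) := by
    simp [BakerData.cAt, chartChoiceAt, hz]
  by_cases hmem : (s : ℂ) * z ∈ B.L.lattice
  · -- chart at the origin: `P₂(s z)`, `s z = (a_r + q m) ω₁ + (c_r + q n) ω₂`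
    have hrmem : (r : ℂ) * z ∈ B.L.lattice := by
      have h2 : (r : ℂ) * z = (s : ℂ) * z - (((q * B.tc.m b : ℤ) : ℂ) * B.L.ω₁ + ((q * B.tc.n b : ℤ) : ℂ) * B.L.ω₂) := by
        rw [hdecomp]; ring
      rw [h2]
      exact sub_mem hmem (B.L.int_mul_add_int_mul_mem_lattice _ _)
    have hcoord := hac r hrmem
    set M₁ : ℤ := (ac r).1 + q * B.tc.m b with hM₁
    set M₂ : ℤ := (ac r).2 + q * B.tc.n b with hM₂
    have hsz : (s : ℂ) * z = (M₁ : ℂ) * B.L.ω₁ + (M₂ : ℂ) * B.L.ω₂ := by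
      rw [hdecomp, ← hcoord, hM₁, hM₂]; push_cast; ring
    have hbase : baseFin (B.cAt s b) = 2 := by rw [hcAt, if_pos hmem]; rfl
    rw [hbase, hsz, B.L.norm_univExtP_two_lattice M₁ M₂]
    -- the exponent
    have hη : ‖(M₁ : ℂ) * B.L.η₁ + (M₂ : ℂ) * B.L.η₂‖ ≤ Aη + s * Hη := by
      have e1 : (M₁ : ℂ) * B.L.η₁ + (M₂ : ℂ) * B.L.η₂ =
          (((ac r).1 : ℂ) * B.L.η₁ + ((ac r).2 : ℂ) * B.L.η₂) + (q : ℂ) * ((B.tc.m b : ℂ) * B.L.η₁ + (B.tc.n b : ℂ) * B.L.η₂) := by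
        rw [hM₁, hM₂]; push_cast; ring
      rw [e1]
      refine (norm_add_le _ _).trans (add_le_add ?_ ?_)
      · exact Finset.single_le_sum (f := fun r => ‖((ac r).1 : ℂ) * B.L.η₁ + ((ac r).2 : ℂ) * B.L.η₂‖)
          (fun _ _ => norm_nonneg _) (Finset.mem_range.mpr hrN)
      · rw [norm_mul, Complex.norm_natCast]
        exact mul_le_mul_of_nonneg_right hqs hHη0
    have hlamn : ‖(M₁ : ℂ) * B.L.ω₁ + (M₂ : ℂ) * B.L.ω₂‖ = s * ‖z‖ := by
      rw [← hsz, norm_mul, Complex.norm_natCast]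
    have hre : -(Clat * (1 + (s : ℝ) ^ 2)) ≤
        3 * (((M₁ : ℂ) * B.L.η₁ + (M₂ : ℂ) * B.L.η₂) * (((M₁ : ℂ) * B.L.ω₁ + (M₂ : ℂ) * B.L.ω₂) / 2)).re := by
      have h1 := Complex.abs_re_le_norm (((M₁ : ℂ) * B.L.η₁ + (M₂ : ℂ) * B.L.η₂) * (((M₁ : ℂ) * B.L.ω₁ + (M₂ : ℂ) * B.L.ω₂) / 2))
      have h2 := neg_abs_le (((M₁ : ℂ) * B.L.η₁ + (M₂ : ℂ) * B.L.η₂) * (((M₁ : ℂ) * B.L.ω₁ + (M₂ : ℂ) * B.L.ω₂) / 2)).re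
      rw [norm_mul, norm_div, hlamn, Complex.norm_two] at h1
      have h3 : ‖(M₁ : ℂ) * B.L.η₁ + (M₂ : ℂ) * B.L.η₂‖ * (s * ‖z‖ / 2) ≤ (Aη + s * Hη) * (s * ‖z‖ / 2) :=
        mul_le_mul_of_nonneg_right hη (by positivity)
      have h4 : (Aη + s * Hη) * (s * ‖z‖ / 2) * 3 ≤ Clat * (1 + (s : ℝ) ^ 2) := by
        have := lin_quad_le (a := Aη) (b := Hη) hAη0 hHη0 s
        rw [hClat]
        nlinarith [norm_nonneg z]
      linarith
    calc min 2 (μ ^ 3) * Real.exp (-(max Clat (3 * Cgen) * (1 + (s : ℝ) ^ 2)))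
        ≤ 2 * Real.exp (-(Clat * (1 + (s : ℝ) ^ 2))) :=
          mul_le_mul (min_le_left _ _) (hexp_mono (le_max_left _ _)) (Real.exp_nonneg _) zero_le_two
      _ ≤ 2 * Real.exp ((((M₁ : ℂ) * B.L.η₁ + (M₂ : ℂ) * B.L.η₂) * (((M₁ : ℂ) * B.L.ω₁ + (M₂ : ℂ) * B.L.ω₂) / 2)).re) ^ 3 := by
          rw [← Real.exp_nat_mul]
          refine mul_le_mul_of_nonneg_left (Real.exp_le_exp.mpr ?_) zero_le_two
          push_cast
          linarith
  · -- generic chart: `P₀(s z) = σ(s z)³`, `σ(s z) = A·σ(r z)`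
    have hrnot : (r : ℂ) * z ∉ B.L.lattice := by
      intro h
      apply hmem
      rw [hdecomp]
      exact add_mem h (B.L.int_mul_add_int_mul_mem_lattice _ _)
    have hbase : baseFin (B.cAt s b) = 0 := by rw [hcAt, if_neg hmem]; rfl
    obtain ⟨p0, -, -⟩ := PeriodPair.univExtP_eq (L := B.L) hmem
    rw [hbase, p0]
    rw [norm_pow]
    have hσ : B.L.weierstrassSigma ((s : ℂ) * z) =
        B.L.sigmaLatticeAut (q * B.tc.m b) (q * B.tc.n b) ((r : ℂ) * z) * B.L.weierstrassSigma ((r : ℂ) * z) := by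
      rw [hdecomp]
      exact B.L.weierstrassSigma_add_lattice _ _ _
    rw [hσ, norm_mul]
    have hA := B.L.norm_sigmaLatticeAut_ge (q * B.tc.m b) (q * B.tc.n b) ((r : ℂ) * z)
    -- the exponent in the automorphy bound
    have hexpo : ‖(((q * B.tc.m b : ℤ)) * B.L.η₁ + ((q * B.tc.n b : ℤ)) * B.L.η₂ : ℂ)‖ *
        (‖(r : ℂ) * z‖ + ‖(((q * B.tc.m b : ℤ)) * B.L.ω₁ + ((q * B.tc.n b : ℤ)) * B.L.ω₂ : ℂ)‖ / 2) ≤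
        Cgen * (1 + (s : ℝ) ^ 2) := by
      have e1 : (((q * B.tc.m b : ℤ)) * B.L.η₁ + ((q * B.tc.n b : ℤ)) * B.L.η₂ : ℂ) =
          (q : ℂ) * ((B.tc.m b : ℂ) * B.L.η₁ + (B.tc.n b : ℂ) * B.L.η₂) := by push_cast; ring
      have e2 : (((q * B.tc.m b : ℤ)) * B.L.ω₁ + ((q * B.tc.n b : ℤ)) * B.L.ω₂ : ℂ) = (q : ℂ) * lam := by
        rw [hlam]; push_cast; ring
      rw [e1, e2, norm_mul, norm_mul, Complex.norm_natCast, Complex.norm_natCast, norm_mul, Complex.norm_natCast]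
      have hrz : (r : ℝ) * ‖z‖ ≤ B.N * ‖z‖ :=
        mul_le_mul_of_nonneg_right (by exact_mod_cast hrN.le) (norm_nonneg _)
      have hq0 : (0 : ℝ) ≤ q := Nat.cast_nonneg q
      calc (q : ℝ) * Hη * ((r : ℝ) * ‖z‖ + (q : ℝ) * ‖lam‖ / 2)
          ≤ (q : ℝ) * Hη * (B.N * ‖z‖ + (s : ℝ) * ‖lam‖ / 2) := by
            refine mul_le_mul_of_nonneg_left (add_le_add hrz ?_) (by positivity)
            exact div_le_div_of_nonneg_right (mul_le_mul_of_nonneg_right hqs (norm_nonneg _)) zero_le_two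
        _ ≤ (s : ℝ) * Hη * (B.N * ‖z‖ + (s : ℝ) * ‖lam‖ / 2) :=
            mul_le_mul_of_nonneg_right (mul_le_mul_of_nonneg_right hqs hHη0) (by positivity)
        _ = (Hη * (B.N * ‖z‖)) * s + (Hη * (‖lam‖ / 2)) * (s : ℝ) ^ 2 := by ring
        _ ≤ (Hη * (B.N * ‖z‖) + Hη * (‖lam‖ / 2)) * (1 + (s : ℝ) ^ 2) :=
            lin_quad_le (by positivity) (by positivity) s
        _ ≤ Cgen * (1 + (s : ℝ) ^ 2) := by
            refine mul_le_mul_of_nonneg_right ?_ (by positivity)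
            rw [hCgen]
            have hX : 0 ≤ Hη * (B.N * ‖z‖ + ‖lam‖ / 2) := by positivity
            have e3 : Hη * (B.N * ‖z‖) + Hη * (‖lam‖ / 2) = Hη * (B.N * ‖z‖ + ‖lam‖ / 2) := by ring
            rw [e3]; linarith
    have hAut : Real.exp (-(Cgen * (1 + (s : ℝ) ^ 2))) ≤
        ‖B.L.sigmaLatticeAut (q * B.tc.m b) (q * B.tc.n b) ((r : ℂ) * z)‖ := by
      refine le_trans (Real.exp_le_exp.mpr ?_) hA
      push_cast at hexpo ⊢
      linarith
    have hσr := hμle r hrN hrnot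
    calc min 2 (μ ^ 3) * Real.exp (-(max Clat (3 * Cgen) * (1 + (s : ℝ) ^ 2)))
        ≤ μ ^ 3 * Real.exp (-(3 * Cgen * (1 + (s : ℝ) ^ 2))) :=
          mul_le_mul (min_le_right _ _) (hexp_mono (le_max_right _ _)) (Real.exp_nonneg _) (pow_nonneg hμpos.le 3)
      _ = (Real.exp (-(Cgen * (1 + (s : ℝ) ^ 2))) * μ) ^ 3 := by
          rw [mul_pow, ← Real.exp_nat_mul]; push_cast; ring_nf
      _ ≤ (‖B.L.sigmaLatticeAut (q * B.tc.m b) (q * B.tc.n b) ((r : ℂ) * z)‖ * ‖B.L.weierstrassSigma ((r : ℂ) * z)‖) ^ 3 :=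
          pow_le_pow_left₀ (by positivity) (mul_le_mul hAut hσr hμpos.le (norm_nonneg _)) 3

/-- **Lower bound for the base theta function at the points `s·v`.** There are `c > 0` and
`C ≥ 0`, depending only on the data, with `c·e^{-C(1+s²)} ≤ |Θ_{J₀(c_s)}(s·v)|` for all `s ∈ ℕ`.
[cite: BakerWustholz2007, §6.8 (p. 119)] -/
theorem exists_theta_baseIdx_ge : ∃ c : ℝ, 0 < c ∧ ∃ C : ℝ, 0 ≤ C ∧ ∀ s : ℕ,
    c * Real.exp (-(C * (1 + (s : ℝ) ^ 2))) ≤ ‖theta B.L B.κM (baseIdx (B.cAt s)) ((s : ℂ) • B.v)‖ := by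
  choose c hc C hC h using fun b => B.exists_univExtP_base_ge b
  refine ⟨∏ b, c b, Finset.prod_pos fun b _ => hc b, ∑ b, C b, Finset.sum_nonneg fun b _ => hC b, fun s => ?_⟩
  rw [theta_baseIdx, norm_prod]
  have e : (∏ b, c b) * Real.exp (-((∑ b, C b) * (1 + (s : ℝ) ^ 2))) =
      ∏ b, c b * Real.exp (-(C b * (1 + (s : ℝ) ^ 2))) := by
    rw [Finset.prod_mul_distrib, ← Real.exp_sum]
    congr 1
    rw [Finset.sum_mul, ← Finset.sum_neg_distrib]
  rw [e]
  refine Finset.prod_le_prod (fun b _ => by have := hc b; positivity) fun b _ => ?_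
  simpa [Pi.smul_apply, smul_eq_mul] using h b s

end BakerData

end Std

end GaGmE

end Literature.NumberTheory.Transcendental

end
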